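import Summits.HodgeConjecture.HodgeCM.PerL34.SeesawChars_1

/-! PORT of `HodgeCM/PerL34/SeesawChars.lean` (HodgeCMPerL run 82) — part 2: continuation of `Summits.HodgeConjecture.HodgeCM.PerL34.SeesawChars_1` (split at a top-level declaration boundary by port_pkg.py; scope re-opened below; declarations unchanged). -/

-- port_pkg: scope re-opened for this part (file-level context, then the namespace/section stack open at the cut)
set_option autoImplicit false
noncomputable section
open Topology Set Function
namespace NumberField
open IsDedekindDomain
open Literature.NumberTheory Literature.NumberTheory.Automorphic
namespace SeesawTorus
section Allowed
variable (L : Type) [Field L] [NumberField L] [IsCMField L]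
local notation "L⁺" => maximalRealSubfield L
variable {L}
variable (L)
variable {L}
/-- `χ̄ = χ⁻¹` of a `χ` of type `(m₁,m₂)` has type `(-m₁,-m₂)` (PerL's `P_{T,\bar χ}`, l. 425). -/
theorem inv_mem_allowedChars {m₁ m₂ : InfinitePlace L → ℤ} {ξ : PontryaginDual (SeesawTorus L⁺ L ⧸ rat L⁺ L)}
    (h : ξ ∈ allowedChars L m₁ m₂) : ξ⁻¹ ∈ allowedChars L (-m₁) (-m₂) :=
  ⟨by rw [charFst_inv]; exact h.1.inv, by rw [charSnd_inv]; exact h.2.inv⟩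

/-- Two characters of the same type differ by a character of type `(0,0)`, i.e. by a character of
`[T]` trivial on the image of `T(L₀ ⊗ ℝ)`. -/
theorem div_mem_allowedChars_zero {m₁ m₂ : InfinitePlace L → ℤ} {ξ η : PontryaginDual (SeesawTorus L⁺ L ⧸ rat L⁺ L)}
    (h : ξ ∈ allowedChars L m₁ m₂) (h' : η ∈ allowedChars L m₁ m₂) : ξ * η⁻¹ ∈ allowedChars L 0 0 := by
  have := mul_mem_allowedChars h (inv_mem_allowedChars h')
  rwa [add_neg_cancel, add_neg_cancel] at this

/-- (Ported verbatim from the HodgeCMPerL package; no docstring in the source.) -/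
theorem mem_allowedChars_zero_iff (ξ : PontryaginDual (SeesawTorus L⁺ L ⧸ rat L⁺ L)) :
    ξ ∈ allowedChars L 0 0 ↔ ∀ t : SeesawArchTorus L, ξ (SeesawArchTorus.toQuot L t) = 1 := by
  rw [mem_allowedChars_iff]
  constructor
  · intro h t
    have ht := DFunLike.congr_fun h t
    rw [MonoidHom.comp_apply, toComplexChar_apply, SeesawArchTorus.weight_apply, archWeight_zero, archWeight_zero,
      mul_one] at ht
    exact Subtype.val_injective (ht.trans Circle.coe_one.symm)
  · intro h
    refine MonoidHom.ext fun t => ?_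
    rw [MonoidHom.comp_apply, toComplexChar_apply, h t, SeesawArchTorus.weight_apply, archWeight_zero, archWeight_zero,
      mul_one, Circle.coe_one]

end Allowed

end SeesawTorus

end NumberField

-- port_pkg: scope closed for this part
end
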